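import Summits.HodgeConjecture.CorCM.GaloisSplitInvolutionTypes
import HarnessLib

/-!
# `D₄ × C_n` (complex conjugation `(r², 1)`) is BAD for EVERY `n ≥ 3`; doubled types in `D_m × C_n`

COR-CM (cell `pub-hodgecm2`), binder seat b04 (gen 29), count-neutral claim SPLIT-INVOLUTION, part II — the symbolic half for
`CorCM/GaloisSplitInvolutionTypes` §3 (there: instances `n = 5, 7` by `decide`).  KERNEL ONLY: theorems; no definition, no named fact,
no `sorry`.  `HC_CM` is neither used nor claimed.

The half of `ℤ/4 × ℤ/n` is `P(t, v) :⟺ t ∈ {k(v), k(v)+1}` with `k = 𝟙_{v = 1}`.  §1 proves, for every `n ≥ 3`, by explicit witnesses: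
`P` is a CM half for `(2, 0)` (`half_cm`), APERIODIC (`half_aperiodic`: a period `(a₁, a₂)` is refuted on the fibres over `0`,
`1 − a₂` or `−a₂`) and `θ`-ASYMMETRIC for `θ(t, v) = (−t, v)` (`half_asymmetric`; the case `(a₁, a₂) = (2, −1)` is the one that
needs `n ≠ 2`).  §2 **`exists_simple_degenerate_dihedralFour_cyclic`**: a Galois CM field `K` with `Gal(K/ℚ) ≅ D₄ × C_n`, complex
conjugation `(r², 1)`, `n ≥ 3`, has a PRIMITIVE DEGENERATE CM type — a simple DEGENERATE abelian variety of dimension `4n` with CM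
by `K` and an exceptional Hodge class on a power.  So the CM dihedral octic fields (`D₄`, GOOD on their own) are spoiled by EVERY
real cyclic factor of degree `≥ 3`: the row `Γ = D₄` of gen 24's «exceptional real factor» table is BAD throughout.  §3
`exists_simple_degenerate_dihedral_times_cyclic_of_half`: the same split involution `(sr 0, 1)` in `D_m × C_n` = `DihedralGroup m × C_n`
for any even `m` (complex conjugation `(r (m/2), 1)`), with the half supplied as a decidable predicate on `ℤ/m × ℤ/n`; instances
**`D₈ × C₃` (order 48) and `D₈ × C₅` (order 80) are BAD** (the dihedral field of degree 16 is GOOD on its own, gen 22).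

## References

* [Kubota1965] T. Kubota, *On the field extension by complex multiplication*, Trans. AMS 118 (1965), §2, §4 Lemma 2.
* [Shimura1998] G. Shimura, *Abelian Varieties with Complex Multiplication and Modular Functions*, §6.2 Thm. 3, §8.2 Prop. 26.
* [Gordon1999HodgeAVSurvey] B. B. Gordon, *A survey of the Hodge conjecture for abelian varieties*, Thm. 6.4, §9.3.
-/

noncomputable section

open CategoryTheory CategoryTheory.Limits NumberField

namespace Summit.HodgeConjecture.CorCM.SplitInvolution

open Literature.NumberTheory.ComplexMultiplication
open Literature.AlgebraicGeometry.Motives (AbelianVariety CMType)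
open Literature.AlgebraicGeometry.HodgeTheory
open Literature.AlgebraicGeometry.ComplexMultiplication (IsCMTypeRealisation)
open Literature.AlgebraicGeometry.Pohlmann1968
open Literature.Barriers.HodgeConjecture (divisorClassesSpan)

/-! ## §1 The half `t ∈ {𝟙_{v=1}(v), 𝟙_{v=1}(v) + 1}` of `ℤ/4 × ℤ/n` -/

section Half

variable {n : ℕ}

/-- The interval bookkeeping on `ℤ/4`. [folklore] -/
theorem interval_facts : ∀ k t : ZMod 4, (k = 0 ∨ k = 1) →
    (((t = k ∨ t = k + 1) ↔ ¬ (2 + t = k ∨ 2 + t = k + 1))) := by decide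

/-- `k = 𝟙_{v=1}` takes the values `0, 1`; `k 1 = 1`, `k v = 0` for `v ≠ 1`. [folklore] -/
theorem indicator_cases (v : ZMod n) : (if v = 1 then (1 : ZMod 4) else 0) = 0 ∨ (if v = 1 then (1 : ZMod 4) else 0) = 1 := by
  by_cases h : v = 1 <;> simp [h]

/-- **CM half.** [folklore] -/
theorem half_cm (s : ZMod 4 × ZMod n) :
    (s.1 = (if s.2 = 1 then 1 else 0) ∨ s.1 = (if s.2 = 1 then 1 else 0) + 1) ↔
      ¬ (((2, 0) + s).1 = (if ((2, 0) + s).2 = 1 then 1 else 0) ∨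
          ((2, 0) + s).1 = (if ((2, 0) + s).2 = 1 then 1 else 0) + 1) := by
  obtain ⟨t, v⟩ := s
  simp only [Prod.mk_add_mk, zero_add]
  exact interval_facts _ t (indicator_cases v)

set_option linter.unusedSimpArgs false in
/-- **Aperiodic** (`n ≥ 2`): no `a ≠ 0` with `P(a + s) ↔ P(s)` for all `s`. [folklore] -/
theorem half_aperiodic (hn : 2 ≤ n) (a : ZMod 4 × ZMod n) (ha : a ≠ 0) :
    ∃ s : ZMod 4 × ZMod n, ¬ ((s.1 = (if s.2 = 1 then 1 else 0) ∨ s.1 = (if s.2 = 1 then 1 else 0) + 1) ↔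
      ((a + s).1 = (if (a + s).2 = 1 then 1 else 0) ∨ (a + s).1 = (if (a + s).2 = 1 then 1 else 0) + 1)) := by
  haveI : Fact (1 < n) := ⟨by omega⟩
  have h10 : (1 : ZMod n) ≠ 0 := one_ne_zero
  have h01 : (0 : ZMod n) ≠ 1 := h10.symm
  obtain ⟨a₁, a₂⟩ := a
  have ha₁ : a₁ = 0 ∨ a₁ = 1 ∨ a₁ = 2 ∨ a₁ = 3 := (by decide : ∀ t : ZMod 4, t = 0 ∨ t = 1 ∨ t = 2 ∨ t = 3) a₁
  by_cases ha₂ : a₂ = 0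
  · subst ha₂
    have ha₁0 : a₁ ≠ 0 := fun h => ha (by rw [h]; rfl)
    rcases ha₁ with rfl | rfl | rfl | rfl
    · exact absurd rfl ha₁0
    · refine ⟨(1, 0), ?_⟩; simp only [Prod.mk_add_mk, add_zero, h01, if_false]; decide
    · refine ⟨(0, 0), ?_⟩; simp only [Prod.mk_add_mk, add_zero, h01, if_false]; decide
    · refine ⟨(0, 0), ?_⟩; simp only [Prod.mk_add_mk, add_zero, h01, if_false]; decide
  · have h1a : (1 : ZMod n) - a₂ ≠ 1 := fun h => ha₂ (by simpa using h)
    have hsum : a₂ + (1 - a₂) = 1 := by ring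
    rcases ha₁ with rfl | rfl | rfl | rfl
    · refine ⟨(0, 1 - a₂), ?_⟩; simp only [Prod.mk_add_mk, hsum, h1a, if_false, if_true, zero_add]; decide
    · by_cases hm : -a₂ = (1 : ZMod n)
      · refine ⟨(1, -a₂), ?_⟩; simp only [Prod.mk_add_mk, if_pos hm, add_neg_cancel, h01, if_false]; decide
      · refine ⟨(1, -a₂), ?_⟩; simp only [Prod.mk_add_mk, if_neg hm, add_neg_cancel, h01, if_false]; decide
    · refine ⟨(1, 1 - a₂), ?_⟩; simp only [Prod.mk_add_mk, hsum, h1a, if_false, if_true]; decide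
    · refine ⟨(0, 1 - a₂), ?_⟩; simp only [Prod.mk_add_mk, hsum, h1a, if_false, if_true, add_zero]; decide

set_option linter.unusedSimpArgs false in
/-- **`θ`-asymmetric** (`n ≥ 3`, `θ(t, v) = (−t, v)`): no `a` with `P(a + θ s) ↔ P(s)` for all `s`. [folklore] -/
theorem half_asymmetric (hn : 3 ≤ n) (a : ZMod 4 × ZMod n) :
    ∃ s : ZMod 4 × ZMod n, ¬ ((s.1 = (if s.2 = 1 then 1 else 0) ∨ s.1 = (if s.2 = 1 then 1 else 0) + 1) ↔
      ((a + (-s.1, s.2)).1 = (if (a + (-s.1, s.2)).2 = 1 then 1 else 0) ∨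
        (a + (-s.1, s.2)).1 = (if (a + (-s.1, s.2)).2 = 1 then 1 else 0) + 1)) := by
  haveI : Fact (1 < n) := ⟨by omega⟩
  have h10 : (1 : ZMod n) ≠ 0 := one_ne_zero
  have h01 : (0 : ZMod n) ≠ 1 := h10.symm
  have hm1 : (-1 : ZMod n) ≠ 1 := by
    intro h
    have h2 : (2 : ZMod n) = 0 := by linear_combination -h
    have : ((2 : ℕ) : ZMod n) = 0 := by exact_mod_cast h2
    rw [ZMod.natCast_eq_zero_iff] at this
    exact absurd (Nat.le_of_dvd (by norm_num) this) (by omega)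
  obtain ⟨a₁, a₂⟩ := a
  have ha₁ : a₁ = 0 ∨ a₁ = 1 ∨ a₁ = 2 ∨ a₁ = 3 := (by decide : ∀ t : ZMod 4, t = 0 ∨ t = 1 ∨ t = 2 ∨ t = 3) a₁
  by_cases ha₂ : a₂ = 0
  · subst ha₂
    rcases ha₁ with rfl | rfl | rfl | rfl
    · refine ⟨(1, 0), ?_⟩; simp only [Prod.mk_add_mk, add_zero, h01, if_false]; decide
    · refine ⟨(1, 1), ?_⟩; simp only [Prod.mk_add_mk, zero_add, if_true]; decide
    · refine ⟨(0, 0), ?_⟩; simp only [Prod.mk_add_mk, add_zero, h01, if_false]; decide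
    · refine ⟨(0, 0), ?_⟩; simp only [Prod.mk_add_mk, add_zero, h01, if_false]; decide
  · have h1a : (1 : ZMod n) - a₂ ≠ 1 := fun h => ha₂ (by simpa using h)
    have hsum : a₂ + (1 - a₂) = 1 := by ring
    rcases ha₁ with rfl | rfl | rfl | rfl
    · refine ⟨(0, 1 - a₂), ?_⟩; simp only [Prod.mk_add_mk, hsum, h1a, if_false, if_true, neg_zero, add_zero]; decide
    · refine ⟨(1, 1 - a₂), ?_⟩; simp only [Prod.mk_add_mk, hsum, h1a, if_false, if_true]; decide
    · by_cases hm : a₂ = -1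
      · subst hm
        refine ⟨(0, 0), ?_⟩; simp only [Prod.mk_add_mk, neg_zero, add_zero, h01, if_false, hm1]; decide
      · have hma : -a₂ ≠ (1 : ZMod n) := fun h => hm (by rw [← h, neg_neg])
        refine ⟨(0, -a₂), ?_⟩; simp only [Prod.mk_add_mk, neg_zero, add_zero, add_neg_cancel, if_neg hma, h01, if_false]; decide
    · refine ⟨(0, 1 - a₂), ?_⟩; simp only [Prod.mk_add_mk, hsum, h1a, if_false, if_true, neg_zero, add_zero]; decide

end Half

/-! ## §2 The theorem -/

section Field

variable {K : Type} [Field K] [NumberField K] [IsCMField K] [IsGalois ℚ K]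

/-- **`Gal(K/ℚ) ≅ D₄ × C_n`, complex conjugation `(r², 1)`, `n ≥ 3` ⟹ `K` is BAD**: a PRIMITIVE DEGENERATE CM type, realised by
a SIMPLE abelian variety of dimension `4n` with CM by `K` carrying a rational `(q,q)` class outside the divisor ring on some power
(the doubled type of the half `t ∈ {𝟙_{v=1}(v), 𝟙_{v=1}(v)+1}` under the split involution `(sr 0, 1)`).
[cite: Kubota1965, §2 and §4 Lemma 2] [cite: Shimura1998, §6.2 Thm. 3 and §8.2 Prop. 26] [cite: Gordon1999HodgeAVSurvey, Thm. 6.4 and §9.3] -/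
theorem exists_simple_degenerate_dihedralFour_cyclic {n : ℕ} [NeZero n] (hn : 3 ≤ n)
    (e : (K ≃ₐ[ℚ] K) ≃* DihedralGroup 4 × Multiplicative (ZMod n))
    (hc : e ((IsCMField.complexConj K).restrictScalars ℚ) = (DihedralGroup.r 2, 1)) :
    ∃ (Φ : CMType K) (φ₀ : K →+* ℂ) (X : AbelianVariety ℂ) (ι : 𝓞 K →+* End X)
      (ϑ : K →+* Module.End ℂ (complexBetti X.X 1)),
      IsPrimitive (ℂ ≃+* ℂ) Φ.1 φ₀ ∧ ¬ IsNondegenerate Φ ∧ IsCMTypeRealisation Φ X ι ϑ ∧ X.IsSimple ∧ X.dim = 4 * n ∧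
      ∃ m q : ℕ, ∃ y : complexBetti (⨁ fun _ : Fin m => X).X (2 * q), IsRationalClass y ∧
        IsOfHodgeType (⨁ fun _ : Fin m => X).dim (⨁ fun _ : Fin m => X).X (2 * q) q q y ∧
        y ∉ divisorClassesSpan (⨁ fun _ : Fin m => X).X (⨁ fun _ : Fin m => X).dim q :=
  exists_simple_degenerate_dihedralFour_cyclic_of_half e hc
    (fun s => s.1 = (if s.2 = 1 then 1 else 0) ∨ s.1 = (if s.2 = 1 then 1 else 0) + 1)
    half_cm (fun a ha => half_aperiodic (by omega) a ha) (half_asymmetric hn)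

end Field

/-! ## §3 `D_m × C_n` for any even `m`: the split involution `(sr 0, 1)`; `D₈ × C₃`, `D₈ × C₅` -/

section Dihedral

variable {K : Type} [Field K] [NumberField K] [IsCMField K] [IsGalois ℚ K]

/-- **`Gal(K/ℚ) ≅ D_m × C_n` (`D_m = DihedralGroup m` of order `2m`, complex conjugation `(r c₀, 1)` with `c₀ ≠ 0`, `2c₀ = 0`) with an
aperiodic `θ`-asymmetric half of `ℤ/m × ℤ/n` (`θ(t,v) = (−t,v)`, half given as a decidable predicate) is BAD**: a simple DEGENERATE
abelian variety of dimension `m n` with CM by `K`. [cite: Kubota1965, §2 and §4 Lemma 2] [cite: Shimura1998, §6.2 Thm. 3 and §8.2 Prop. 26]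
[cite: Gordon1999HodgeAVSurvey, Thm. 6.4 and §9.3] -/
theorem exists_simple_degenerate_dihedral_times_cyclic_of_half {m n : ℕ} [NeZero m] [NeZero n] (c₀ : ZMod m) (hc₀ : c₀ ≠ 0)
    (h2c₀ : c₀ + c₀ = 0) (e : (K ≃ₐ[ℚ] K) ≃* DihedralGroup m × Multiplicative (ZMod n))
    (hc : e ((IsCMField.complexConj K).restrictScalars ℚ) = (DihedralGroup.r c₀, 1))
    (P : ZMod m × ZMod n → Prop) [DecidablePred P] (hP : ∀ s, P s ↔ ¬ P ((c₀, 0) + s))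
    (haper : ∀ a : ZMod m × ZMod n, a ≠ 0 → ∃ s, ¬ (P s ↔ P (a + s)))
    (hasym : ∀ a : ZMod m × ZMod n, ∃ s, ¬ (P s ↔ P (a + (-s.1, s.2)))) :
    ∃ (Φ : CMType K) (φ₀ : K →+* ℂ) (X : AbelianVariety ℂ) (ι : 𝓞 K →+* End X)
      (ϑ : K →+* Module.End ℂ (complexBetti X.X 1)),
      IsPrimitive (ℂ ≃+* ℂ) Φ.1 φ₀ ∧ ¬ IsNondegenerate Φ ∧ IsCMTypeRealisation Φ X ι ϑ ∧ X.IsSimple ∧ X.dim = m * n ∧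
      ∃ m' q : ℕ, ∃ y : complexBetti (⨁ fun _ : Fin m' => X).X (2 * q), IsRationalClass y ∧
        IsOfHodgeType (⨁ fun _ : Fin m' => X).dim (⨁ fun _ : Fin m' => X).X (2 * q) q q y ∧
        y ∉ divisorClassesSpan (⨁ fun _ : Fin m' => X).X (⨁ fun _ : Fin m' => X).dim q := by
  classical
  let i₁ : Multiplicative (ZMod m) →* DihedralGroup m :=
    MonoidHom.mk' (fun u => DihedralGroup.r (Multiplicative.toAdd u)) fun u v => by simp [toAdd_mul]
  let i : Multiplicative (ZMod m) × Multiplicative (ZMod n) →* DihedralGroup m × Multiplicative (ZMod n) :=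
    MonoidHom.prodMap i₁ (MonoidHom.id _)
  have hi_apply : ∀ u v, i (u, v) = (DihedralGroup.r (Multiplicative.toAdd u), v) := fun u v => rfl
  have hi : Function.Injective i := by
    rintro ⟨u, v⟩ ⟨u', v'⟩ h
    simp only [hi_apply, Prod.mk.injEq, DihedralGroup.r.injEq] at h
    exact Prod.ext (by simpa using h.1) h.2
  set x : DihedralGroup m × Multiplicative (ZMod n) := (DihedralGroup.sr 0, 1) with hx_def
  have hx : ∀ w, i w ≠ x := fun ⟨u, v⟩ => by simp [hi_apply, hx_def]
  have hcov : ∀ g : DihedralGroup m × Multiplicative (ZMod n), (∃ w, g = i w) ∨ (∃ w, g = i w * x) := by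
    rintro ⟨j | j, v⟩
    · exact Or.inl ⟨(Multiplicative.ofAdd j, v), by simp [hi_apply]⟩
    · exact Or.inr ⟨(Multiplicative.ofAdd (-j), v), by simp [hi_apply, hx_def]⟩
  let θ : Multiplicative (ZMod m) × Multiplicative (ZMod n) ≃* Multiplicative (ZMod m) × Multiplicative (ZMod n) :=
    MulEquiv.prodCongr (MulEquiv.inv _) (MulEquiv.refl _)
  have hθ_apply : ∀ w, θ w = (w.1⁻¹, w.2) := fun w => rfl
  have hθ : ∀ w, x * i w = i (θ w) * x := fun ⟨u, v⟩ => by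
    simp [hi_apply, hθ_apply, hx_def]
  have hxx : x * x = 1 := by simp [hx_def]
  set c : Multiplicative (ZMod m) × Multiplicative (ZMod n) := (Multiplicative.ofAdd c₀, 1) with hc_def
  have hic : i c = (DihedralGroup.r c₀, 1) := rfl
  have hc1 : c ≠ 1 := by
    rw [hc_def, Ne, Prod.mk_eq_one, not_and_or]
    exact Or.inl fun h => hc₀ (by simpa using congrArg Multiplicative.toAdd h)
  have hcc : c * c = 1 := by rw [hc_def, Prod.mk_mul_mk, mul_one, ← ofAdd_add, h2c₀]; rfl
  have hθc : θ c = c := by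
    rw [hθ_apply, hc_def]; refine Prod.ext ?_ rfl
    change Multiplicative.ofAdd (-c₀) = Multiplicative.ofAdd c₀
    rw [neg_eq_of_add_eq_zero_left h2c₀]
  set S : Finset (Multiplicative (ZMod m) × Multiplicative (ZMod n)) :=
    Finset.univ.filter fun w => P (Multiplicative.toAdd w.1, Multiplicative.toAdd w.2) with hS_def
  have hSmem : ∀ w : Multiplicative (ZMod m) × Multiplicative (ZMod n),
      w ∈ S ↔ P (Multiplicative.toAdd w.1, Multiplicative.toAdd w.2) := fun w => by simp [hS_def]
  have hS : ∀ a, a ∈ S ↔ c * a ∉ S := fun a => by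
    rw [hSmem, hSmem, hc_def, Prod.fst_mul, Prod.snd_mul, one_mul, toAdd_mul, toAdd_ofAdd, hP]
    simp only [Prod.mk_add_mk, zero_add]
  have haper' : ∀ a : Multiplicative (ZMod m) × Multiplicative (ZMod n), a ≠ 1 → ∃ s, ¬ (s ∈ S ↔ a * s ∈ S) := by
    intro a ha
    have ha' : (Multiplicative.toAdd a.1, Multiplicative.toAdd a.2) ≠ (0 : ZMod m × ZMod n) := by
      intro h
      apply ha
      rw [Prod.mk_eq_zero] at h
      exact Prod.ext (toAdd_eq_zero.1 h.1) (toAdd_eq_zero.1 h.2)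
    obtain ⟨⟨s₁, s₂⟩, hs⟩ := haper _ ha'
    refine ⟨(Multiplicative.ofAdd s₁, Multiplicative.ofAdd s₂), ?_⟩
    simpa only [hSmem, Prod.fst_mul, Prod.snd_mul, toAdd_mul, toAdd_ofAdd, Prod.mk_add_mk] using hs
  have hasym' : ∀ a : Multiplicative (ZMod m) × Multiplicative (ZMod n), ∃ s, ¬ (s ∈ S ↔ a * θ s ∈ S) := by
    intro a
    obtain ⟨⟨s₁, s₂⟩, hs⟩ := hasym (Multiplicative.toAdd a.1, Multiplicative.toAdd a.2)
    refine ⟨(Multiplicative.ofAdd s₁, Multiplicative.ofAdd s₂), ?_⟩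
    simpa only [hSmem, hθ_apply, Prod.fst_mul, Prod.snd_mul, toAdd_mul, toAdd_ofAdd, toAdd_inv, Prod.mk_add_mk] using hs
  obtain ⟨Φ, φ₀, X, ι, ϑ, h1, h2, h3, h4, h5, h6⟩ := exists_simple_degenerate_of_split_involution e i hi x hx hcov θ hθ hxx hc1
    hcc hθc (by rw [hic]; exact hc) S hS haper' hasym'
  refine ⟨Φ, φ₀, X, ι, ϑ, h1, h2, h3, h4, ?_, h6⟩
  rw [h5, Fintype.card_prod, Fintype.card_multiplicative, ZMod.card, DihedralGroup.card, Nat.mul_assoc,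
    Nat.mul_div_cancel_left _ Nat.two_pos]

/-- **`D₈ × C₃` (order 48, complex conjugation `(r⁴, 1)`) is BAD** — doubled type of the interval half
`{(t,v) : t − 4·𝟙_{v=1}(v) ∈ {0,1,2,3}}`; the dihedral CM field of degree 16 alone is GOOD (gen 22).
[cite: Shimura1998, §6.2 Thm. 3 and §8.2 Prop. 26] [cite: Gordon1999HodgeAVSurvey, Thm. 6.4 and §9.3] -/
theorem exists_simple_degenerate_dihedralEight_cyclicThree
    (e : (K ≃ₐ[ℚ] K) ≃* DihedralGroup 8 × Multiplicative (ZMod 3))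
    (hc : e ((IsCMField.complexConj K).restrictScalars ℚ) = (DihedralGroup.r 4, 1)) :
    ∃ (Φ : CMType K) (φ₀ : K →+* ℂ) (X : AbelianVariety ℂ) (ι : 𝓞 K →+* End X)
      (ϑ : K →+* Module.End ℂ (complexBetti X.X 1)),
      IsPrimitive (ℂ ≃+* ℂ) Φ.1 φ₀ ∧ ¬ IsNondegenerate Φ ∧ IsCMTypeRealisation Φ X ι ϑ ∧ X.IsSimple ∧ X.dim = 8 * 3 ∧
      ∃ m' q : ℕ, ∃ y : complexBetti (⨁ fun _ : Fin m' => X).X (2 * q), IsRationalClass y ∧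
        IsOfHodgeType (⨁ fun _ : Fin m' => X).dim (⨁ fun _ : Fin m' => X).X (2 * q) q q y ∧
        y ∉ divisorClassesSpan (⨁ fun _ : Fin m' => X).X (⨁ fun _ : Fin m' => X).dim q :=
  exists_simple_degenerate_dihedral_times_cyclic_of_half 4 (by decide) (by decide) e hc
    (fun s => s.1 - (if s.2 = 1 then 1 else 0) = 0 ∨ s.1 - (if s.2 = 1 then 1 else 0) = 1 ∨
      s.1 - (if s.2 = 1 then 1 else 0) = 2 ∨ s.1 - (if s.2 = 1 then 1 else 0) = 3)
    (by decide) (by decide) (by decide)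

/-- **`D₈ × C₅` (order 80, complex conjugation `(r⁴, 1)`) is BAD** (same half).
[cite: Shimura1998, §6.2 Thm. 3 and §8.2 Prop. 26] [cite: Gordon1999HodgeAVSurvey, Thm. 6.4 and §9.3] -/
theorem exists_simple_degenerate_dihedralEight_cyclicFive
    (e : (K ≃ₐ[ℚ] K) ≃* DihedralGroup 8 × Multiplicative (ZMod 5))
    (hc : e ((IsCMField.complexConj K).restrictScalars ℚ) = (DihedralGroup.r 4, 1)) :
    ∃ (Φ : CMType K) (φ₀ : K →+* ℂ) (X : AbelianVariety ℂ) (ι : 𝓞 K →+* End X)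
      (ϑ : K →+* Module.End ℂ (complexBetti X.X 1)),
      IsPrimitive (ℂ ≃+* ℂ) Φ.1 φ₀ ∧ ¬ IsNondegenerate Φ ∧ IsCMTypeRealisation Φ X ι ϑ ∧ X.IsSimple ∧ X.dim = 8 * 5 ∧
      ∃ m' q : ℕ, ∃ y : complexBetti (⨁ fun _ : Fin m' => X).X (2 * q), IsRationalClass y ∧
        IsOfHodgeType (⨁ fun _ : Fin m' => X).dim (⨁ fun _ : Fin m' => X).X (2 * q) q q y ∧
        y ∉ divisorClassesSpan (⨁ fun _ : Fin m' => X).X (⨁ fun _ : Fin m' => X).dim q :=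
  exists_simple_degenerate_dihedral_times_cyclic_of_half 4 (by decide) (by decide) e hc
    (fun s => s.1 - (if s.2 = 1 then 1 else 0) = 0 ∨ s.1 - (if s.2 = 1 then 1 else 0) = 1 ∨
      s.1 - (if s.2 = 1 then 1 else 0) = 2 ∨ s.1 - (if s.2 = 1 then 1 else 0) = 3)
    (by decide) (by decide) (by decide)

end Dihedral

end Summit.HodgeConjecture.CorCM.SplitInvolution

end
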